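import Literature.AnabelianGeometry.AbsoluteAnabelian.RigidFunctors
import Mathlib.CategoryTheory.Action.Concrete
import HarnessLib

/-!
# Natural endomorphisms of the identity functor of `G-Set` are the central elements of `G`;
# `G-Set` is id-rigid iff `G` is centre-free

Topic `Literature/GroupTheory` — algebraic half of the id-rigidity of categories of (all) covering
spaces (abc-iut cell, campaign-L R1, GAP row G-L4t14-R1; the DISCRETE twin of «`B(Π)` id-rigid for
slim `Π`», the tree's `isIdRigid_bCat_of_isSlimGroup`).  Folklore (the centre of the category of
`G`-sets: `End(𝟭_{G-Set}) ≅ Z(G)`, e.g. Mac Lane–Moerdijk §I.1 / SGA 1 V §4 for the fibre functor):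

* `natTrans_app_apply` — a natural transformation `α : 𝟭 ⟶ 𝟭` of `Action (Type u) G` acts on every
  `G`-set `A` by `a ↦ z • a`, `z := α_G(1)` for the regular `G`-set `G` (naturality at the orbit map
  `G → A`, `g ↦ g • a`);
* `regApp_one_mem_center` — `z` is CENTRAL (naturality at the right translations
  `G → G`, which are `G`-equivariant, against equivariance of `α_G`);
* `natTransOfCenter` — conversely every central `z` acts naturally; hence
* **`isIdRigid_action_of_center_eq_bot`**, `center_eq_bot_of_isIdRigid_action`,
  **`isIdRigid_action_iff_center_eq_bot`** — `Action (Type u) G` is id-rigid (every automorphism of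
  its identity functor is trivial, the tree's `IsIdRigid`) iff `Z(G) = 1`.

Everything is proved; definitions `regApp`, `orbitHom`, `rightMulHom`, `natTransOfCenter`; no instances; no named facts.

## References

* S. Mochizuki, *Topics in Absolute Anabelian Geometry III*, §0 p. 27 (id-rigid categories; slim ⇒
  id-rigid). [MochizukiAbsTopIII2015]
* S. Mac Lane, I. Moerdijk, *Sheaves in Geometry and Logic*, §I.1 (the topos of `G`-sets).
-/

noncomputable section

open CategoryTheory
open Literature.AnabelianGeometry.AbsoluteAnabelian (IsIdRigid IsRigidFunctor)

universe u

namespace Literature.GroupTheory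

namespace ActionCenter

variable {G : Type u} [Group G]

/-- The orbit map `G → A`, `g ↦ ρ(g) a`, as a morphism of `G`-sets from the regular `G`-set.
[cite: MochizukiAbsTopIII2015, Section 0 p.27] -/
def orbitHom (A : Action (Type u) G) (a : A.V) : Action.leftRegular G ⟶ A where
  hom := TypeCat.ofHom fun g : G ↦ A.ρ g a
  comm g := by
    ext (h : G)
    change A.ρ (g * h) a = A.ρ g (A.ρ h a)
    rw [map_mul]
    rfl

/-- The orbit map sends `g` to `ρ(g) a`. [cite: MochizukiAbsTopIII2015, Section 0 p.27] -/
@[simp] theorem orbitHom_apply (A : Action (Type u) G) (a : A.V) (g : G) :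
    (orbitHom A a).hom g = A.ρ g a := rfl

/-- Right translation `x ↦ x * g` is an endomorphism of the regular `G`-set.
[cite: MochizukiAbsTopIII2015, Section 0 p.27] -/
def rightMulHom (g : G) : Action.leftRegular G ⟶ Action.leftRegular G where
  hom := TypeCat.ofHom fun x : G ↦ x * g
  comm h := by
    ext (x : G)
    change h • x * g = h • (x * g)
    rw [smul_eq_mul, smul_eq_mul, mul_assoc]

/-- Right translation on elements. [cite: MochizukiAbsTopIII2015, Section 0 p.27] -/
@[simp] theorem rightMulHom_apply (g x : G) : (rightMulHom g).hom x = x * g := rfl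

/-- The value of a natural transformation `α : 𝟭 ⟶ 𝟭` on the regular `G`-set, as a map `G → G`
(`regApp α 1` is «`z = α_G(1)`»). [cite: MochizukiAbsTopIII2015, Section 0 p.27] -/
def regApp (α : 𝟭 (Action (Type u) G) ⟶ 𝟭 (Action (Type u) G)) (g : G) : G :=
  (α.app (Action.leftRegular G)).hom g

/-- **A natural endomorphism of `𝟭_{G-Set}` acts on every `G`-set through its value `z = α_G(1)` on
the regular representation**: `α_A(a) = ρ_A(z) a` (naturality at the orbit map of `a`).
[cite: MochizukiAbsTopIII2015, Section 0 p.27] -/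
theorem natTrans_app_apply (α : 𝟭 (Action (Type u) G) ⟶ 𝟭 (Action (Type u) G))
    (A : Action (Type u) G) (a : A.V) :
    (α.app A).hom a = A.ρ (regApp α 1) a := by
  -- evaluate the naturality square at the orbit map at `1 : G`
  have h1 := congrArg (fun φ : Action.leftRegular G ⟶ A ↦ φ.hom (1 : G)) (α.naturality (orbitHom A a))
  simp only [Functor.id_obj, Functor.id_map, Action.comp_hom, types_comp_apply, orbitHom_apply] at h1
  rw [Action.ρ_one, types_id_apply] at h1
  exact h1

/-- Equivariance of `α_G`: `α_G(g) = g · α_G(1)`. [cite: MochizukiAbsTopIII2015, Section 0 p.27] -/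
theorem regApp_eq_mul (α : 𝟭 (Action (Type u) G) ⟶ 𝟭 (Action (Type u) G)) (g : G) :
    regApp α g = g * regApp α 1 := by
  have hc := ConcreteCategory.congr_hom ((α.app (Action.leftRegular G)).comm g) (1 : G)
  change regApp α (g * 1) = g * regApp α 1 at hc
  rwa [mul_one] at hc

/-- Naturality of `α` at the right translation `x ↦ x g` of the regular `G`-set: `α_G(g) = α_G(1) · g`.
[cite: MochizukiAbsTopIII2015, Section 0 p.27] -/
theorem regApp_eq_mul' (α : 𝟭 (Action (Type u) G) ⟶ 𝟭 (Action (Type u) G)) (g : G) :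
    regApp α g = regApp α 1 * g := by
  have h1 := congrArg (fun φ : Action.leftRegular G ⟶ Action.leftRegular G ↦ φ.hom (1 : G))
    (α.naturality (rightMulHom g))
  change regApp α (1 * g) = regApp α 1 * g at h1
  rwa [one_mul] at h1

/-- **`z = α_G(1)` is central**: `α_G` commutes with the left action (equivariance) and with right
translations (naturality), so `z g = α_G(g) = g z`. [cite: MochizukiAbsTopIII2015, Section 0 p.27] -/
theorem regApp_one_mem_center (α : 𝟭 (Action (Type u) G) ⟶ 𝟭 (Action (Type u) G)) :
    regApp α 1 ∈ Subgroup.center G :=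
  Subgroup.mem_center_iff.2 fun g ↦ by rw [← regApp_eq_mul, regApp_eq_mul']

variable (G) in
/-- **Every central element acts naturally on all `G`-sets**: the natural automorphism
`a ↦ ρ(z) a` of `𝟭_{G-Set}`. [cite: MochizukiAbsTopIII2015, Section 0 p.27] -/
def natTransOfCenter (z : Subgroup.center G) : 𝟭 (Action (Type u) G) ⟶ 𝟭 (Action (Type u) G) where
  app A :=
    { hom := A.ρ (z : G)
      comm := fun g ↦ by
        change A.ρ (z : G) * A.ρ g = A.ρ g * A.ρ (z : G)
        rw [← map_mul, ← map_mul, Subgroup.mem_center_iff.1 z.2 g] }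
  naturality A B f := by
    apply Action.Hom.ext
    simp only [Functor.id_obj, Functor.id_map, Action.comp_hom]
    exact (f.comm (z : G)).symm

/-- The natural transformation of a central element acts by that element.
[cite: MochizukiAbsTopIII2015, Section 0 p.27] -/
@[simp] theorem natTransOfCenter_app_hom (z : Subgroup.center G) (A : Action (Type u) G) :
    ((natTransOfCenter G z).app A).hom = A.ρ (z : G) := rfl

/-- **`Z(G) = 1` ⇒ `G-Set` is id-rigid**: every automorphism (indeed endomorphism) of the identity
functor of `Action (Type u) G` is the identity. [cite: MochizukiAbsTopIII2015, Section 0 p.27] -/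
theorem isIdRigid_action_of_center_eq_bot (h : Subgroup.center G = ⊥) :
    IsIdRigid (Action (Type u) G) := by
  intro α
  have hz : regApp α.hom 1 = 1 := by
    have := regApp_one_mem_center α.hom
    rw [h] at this
    exact Subgroup.mem_bot.1 this
  ext A a
  change (α.hom.app A).hom a = a
  rw [natTrans_app_apply α.hom A a, hz, Action.ρ_one, types_id_apply]

/-- **`G-Set` id-rigid ⇒ `Z(G) = 1`**: a central `z ≠ 1` acts non-trivially (on the regular
representation) yet naturally. [cite: MochizukiAbsTopIII2015, Section 0 p.27] -/
theorem center_eq_bot_of_isIdRigid_action (h : IsIdRigid (Action (Type u) G)) :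
    Subgroup.center G = ⊥ := by
  rw [eq_bot_iff]
  intro z hz
  rw [Subgroup.mem_bot]
  let zc : Subgroup.center G := ⟨z, hz⟩
  -- the natural AUTOmorphism of `𝟭` given by `z` (inverse: `z⁻¹`)
  let α : 𝟭 (Action (Type u) G) ≅ 𝟭 (Action (Type u) G) :=
    { hom := natTransOfCenter G zc
      inv := natTransOfCenter G zc⁻¹
      hom_inv_id := by
        ext A a
        change A.ρ ((zc⁻¹ : Subgroup.center G) : G) (A.ρ (zc : G) a) = a
        have hmul : A.ρ ((zc⁻¹ : Subgroup.center G) : G) * A.ρ (zc : G) = 1 := by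
          rw [← map_mul, Subgroup.coe_inv, inv_mul_cancel, map_one]
        exact ConcreteCategory.congr_hom hmul a
      inv_hom_id := by
        ext A a
        change A.ρ (zc : G) (A.ρ ((zc⁻¹ : Subgroup.center G) : G) a) = a
        have hmul : A.ρ (zc : G) * A.ρ ((zc⁻¹ : Subgroup.center G) : G) = 1 := by
          rw [← map_mul, Subgroup.coe_inv, mul_inv_cancel, map_one]
        exact ConcreteCategory.congr_hom hmul a }
  have hα := h α
  have h1 : regApp α.hom 1 = regApp (Iso.refl (𝟭 (Action (Type u) G))).hom 1 := by rw [hα]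
  change z • (1 : G) = 1 at h1
  simpa using h1

/-- **`Action (Type u) G` is id-rigid iff `G` is centre-free.** [cite: MochizukiAbsTopIII2015, Section 0 p.27] -/
theorem isIdRigid_action_iff_center_eq_bot :
    IsIdRigid (Action (Type u) G) ↔ Subgroup.center G = ⊥ :=
  ⟨center_eq_bot_of_isIdRigid_action, isIdRigid_action_of_center_eq_bot⟩

end ActionCenter

end Literature.GroupTheory

end
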